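import Summits.QuantumFields.BalabanUV.Beta.FP.GhostLoopCountingFar
import Summits.QuantumFields.BalabanUV.Beta.FP.MixLoopPowerCountingMassQuartic

/-!
# `BalabanUV.Beta.FP.GhostLoopCountingWindow` — road «FP» for binder row D1, organisation γ, row **(GH-a) COUNTING** (owner ruling R-FP-28 (d),
# piece list N-d1leaf05g12-1 adopted): piece **(g1)** «THE WINDOW MISMATCH OF THE GHOST BUBBLE» — the one-smooth-leg × one-long-leg window terms
# `𝟙[‖b′−b‖∞ ≤ N]·[∇E·∇G₀]` (ONE lattice difference PER LEG) and their smooth–smooth twin `𝟙_window·[∇E·∇E]` — delivered in the WINDOWED-MAJORANT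
# currency (Mκ) of the J-contraction lemma `FP/MixLoopPowerCountingMassQuartic.coarse_secondMoment_of_majorant`, and J-contracted BY NAME
# ([folklore] lattice bookkeeping on `ℤ⁴`; abstract kernels; every letter a displayed hypothesis; NO road object)

HONEST DEPENDENCY (page 1, mandatory): continuum YM on T⁴ ⇐ BetaPertH ∧ nine spine estimates (0/9 proved); BetaPertH ⇐ (D1) ∧ (D4) ∧
CAP+tail; G-an2-4 gates asym, D1 and NE2/3/4.  HONEST FRAMING (cell contract, verbatim): «discharging `BetaPertH` makes Bałaban's UV
stability UNCONDITIONAL — a real constructive-QFT result; it is NOT the continuum limit and NOT the Clay problem.»  THIS MODULE is elementary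
[folklore] real analysis on `ℤ⁴` composed BY NAME from the tree: the sibling `FP/GhostLoopCountingFar` ((g2)(g3): `sum_exp_recentre_le` — the reference row
weight's mass, exact power `n⁴` —, `majorantLetter_local`, `majorantLetter_add`), `FP/MixLoopPowerCountingMassQuartic.coarse_secondMoment_of_majorant` (the
J-contraction), `FP/FarRegionMoment.subset_box_max`∕`sum_box_eq_sum_box_add_sum_annulus`, `TransferUV.card_annulus_succ_four_le`∕`sum_annulus_zero_eq_sum_shells`
(`#{‖z‖∞ = r+1} ≤ 80(r+1)³`), `BlockAveragedKernel.box_four_zero`.  It asserts nothing about Bałaban's objects, cites nothing, mints no `Prop` fact, has no `def`,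
0 sorry.  NOT (GH-a) ((g2)(g3) are the sibling file, (g4)(g5) are NOT here), NOT `hbook`, NOT D1, NOT BetaPertH, NOT continuum, NOT Clay.

ABSOLUTE RULE (cell charter, verbatim): «No internally-minted statement may enter as a cited fact. Every hypothesis is either kernel-proved in this
package or a verbatim quotation of a PUBLISHED theorem with page reference. The manuscript(s) under audit are NOT citable for their own disputed
steps — they are the thing under adjudication; programme-internal (2001/route/tribunal) claims are never citable.»

ROW (road FP OWNER b2b-balaban-beta-d1-p3 gen 8, R-FP-28 (d), CLAIMS.log l.25755; LEAVES-FP «(GH-a) COUNTING … first refusal beta-d1-formalise-leaf-05 lineage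
ON EVENT (`MixLoopPowerCountingMassQuartic` landed)»; the event fired with p245963; piece list NOTE N-d1leaf05g12-1, CLAIMS.log l.25681): the ghost remainder
`T^{gh} − Xtr^{gh} = Σ_i (v ↦ Σ_{b,b′} J b v₀·J b′ v·k_i(b,b′))` is a sum of five J-contracted fine kernels, each delivered by `coarse_secondMoment_of_majorant` with
its windowed-majorant letter (Mκ_i) `Σ_{b∈S} Σ_{b′∈S} e^{−(δ∕(2n))‖b − n•v₀‖∞} · (1 + (‖b′ − b‖∞∕n)²) · κ b b′ ≤ A_κ` (binder `hMκ`, VERBATIM).  PROVENANCE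
(precision E-d1leaf05g12-1): (g1) is a piece of the (pp)∕(rem) decomposition OF RECORD = the KKT form `FP/GhostGramJets.hasDerivAt_ghostFirstVar` with
`FP/GhostPairingSplit.ghost_dictionary` (`Γ = G₀ + E`): on the window of the truncated transport `Xtr^{gh}`,
`½[∇Γ·∇Γ] − ½[∇G₀·∇G₀] = ½[∇E·∇G₀] + ½[∇G₀·∇E] + ½[∇E·∇E]`; nothing of those identities is used or restated here — the kernels are ABSTRACT.

BINDING CHECK (R-FP-28 (d), DISPLAYED): every window term carries ONE lattice difference PER LEG — the long leg `∇G₀` enters ONLY through a degree-3 profile letter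
`|L_F z| ≤ A₁∕(‖z‖∞+1)³` (shape of `BlockAveragedKernelLegs.letterDiff_free`), the smooth leg `∇E` ONLY through a window sup letter `|L_R b b′| ≤ B₁` (shape of IR-4 (T1)
`ConstrainedGhostIRFinal.abs_ghostRem_sub_le`, instance `B₁ = K₁·n⁻³`) ⟹ `|k| ≤ |c|·B₁·A₁∕(‖b′−b‖∞+1)³` on the window, windowed ℓ¹ row mass `≤ |c|·B₁·A₁·(1 + 80N)` —
LINEAR in `N`, NO logarithm ⟹ «(Mκ₁) admissible AS TYPED».  NO term with two differences on the long leg is typed: a consumer who rewrites `[∇E·∇G₀]` as `E·∇∇G₀`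
(windowed row mass `≍ A·B·n⁻²·ln n`, RISK R-γ-15) leaves this file's hypotheses and must use the pair currency `CoarseContractionProfile.pp_of_pair`.

CONTENT ([folklore]; `Θ := 1 + 480·e^{δ∕4}·(4∕δ)⁴`, the row weight's mass constant of `sum_exp_recentre_le`):
* §0 `shell_inv_cube_le`, **`sum_box_inv_cube_le`** (`Σ_{z∈box 4 N}(‖z‖∞+1)⁻³ ≤ 1 + 80N`), **`sum_window_sqWeight_le`**
  (`Σ_{z∈T} 𝟙[‖z‖∞≤N]·(1 + (‖z‖∞∕n)²)·C∕(‖z‖∞+1)³ ≤ (1 + 80N)·((1 + (N∕n)²)·C)`, every finite `T`).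
* §1 **`majorantLetter_window`** — (win-0) `N < ‖b′−b‖∞ → k b b′ = 0`, (win) `‖b′−b‖∞ ≤ N → |k b b′| ≤ C∕(‖b′−b‖∞+1)³` ⟹ (Mκ) with
  `A_κ = Θ·n⁴·((1 + 80N)·((1 + (N∕n)²)·C))`; `majorantLetter_window_of_legs` (`k = c·L_R·L_F` on the window ⟹ `C = |c|·B₁·A₁`);
  **`majorantLetter_window_scale`** — THE INSTANCE POWER at `N = n`, `B₁ = B∕n³`: `A_κ ≤ Θ·(162·(|c|·A₁·B))·n²` (the same `n²` as (g2)'s `majorantLetter_far`).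
* §2 `majorantLetter_window_smooth` — the smooth–smooth window term (`k = c·L_R·L_R′`) = `GhostLoopCountingFar.majorantLetter_local` BY NAME at `r = N`,
  `C_loc = |c|·B₁·B₁′`; `majorantLetter_window_smooth_scale` (`N = n`, `B₁ = B∕n³`, `B₁′ = B′∕n³`): `A_κ ≤ Θ·(162·(|c|·B·B′))·n²` (`(2n+1)⁴ ≤ 81n⁴`).
* §3 `majorantLetter_add₃`, **`majorantLetter_mismatch_scale`** — the three window terms together: `A_κ₁ = Θ·162·(|c₁|A₁B + |c₂|A₁′B′ + |c₃|BB′)·n²`.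
* §4 **`secondMoment_of_majorantLetter`** — the J-contraction BY NAME at `κ := |k|`: any kernel with an (Mκ) letter `A_κ` has
  `Σ_{v∈V}‖v−v₀‖∞²·|Σ_{b,b′∈S} J b v₀·J b′ v·k b b′| ≤ 3·C_J·C_J′·(1 + 16∕δ²)·A_κ`; `secondMoment_window` = §1 ∘ §4.
The powers of `n` are DISPLAYED: the instance values of `A₁, B, B′, c_i, C_J, C_J′` and their units are row RHOA-6e's bookkeeping (as in the sibling files).
Provenance: D1 formalisation swarm, unit `b2b-balaban-beta-d1-formalise-leaf-05` gen 13 (prover-b2b-balaban-beta-d1-formalise-leaf-05-g13-0), 2026-08-21,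
first-refusal holder of (GH-a) COUNTING by R-FP-28 (d); journal CLAIM «(GH-a) (g1)» 2026-08-21T03:12Z; «not in print; our bookkeeping»; no existing file touched.
-/

noncomputable section

namespace Summit.QuantumFields.BalabanUV.Beta.FP.GhostLoopCountingWindow

open Finset Real
open scoped BigOperators
open Literature.Probability.LatticeModels (box annulus box_mono card_box)
open Literature.MathematicalPhysics.QuantumFieldTheory.Balaban1983to89.Beta.TransferUV (card_annulus_succ_four_le sum_annulus_zero_eq_sum_shells)
open Literature.MathematicalPhysics.QuantumFieldTheory.Balaban1983to89.Beta.DyadicShell (Pt supNorm mem_box_iff mem_annulus_iff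
  supNorm_eq_zero_iff supNorm_eq_of_mem_sphere)
open Summit.QuantumFields.BalabanUV.Beta.FP.BlockAveragedKernel (box_four_zero)
open Summit.QuantumFields.BalabanUV.Beta.FP.MixLoopPowerCounting (supNorm_cast_nonneg)
open Summit.QuantumFields.BalabanUV.Beta.FP.FarRegionMoment (subset_box_max sum_box_eq_sum_box_add_sum_annulus)
open Summit.QuantumFields.BalabanUV.Beta.FP.GhostLoopCountingFar (sum_exp_recentre_le majorantLetter_local majorantLetter_add)
open Summit.QuantumFields.BalabanUV.Beta.FP.MixLoopPowerCountingMassQuartic (coarse_secondMoment_of_majorant)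

/-! ## §0 The window count of a degree-3 profile on `ℤ⁴` — linear in the radius, no logarithm -/

/-- [folklore] ONE SHELL: `#{‖z‖∞ = r+1}·(r+2)⁻³ ≤ 80` (`#shell ≤ 80(r+1)³ ≤ 80(r+2)³`). -/
theorem shell_inv_cube_le (r : ℕ) :
    ((annulus 4 r (r + 1)).card : ℝ) * ((((r : ℝ) + 1) + 1) ^ 3)⁻¹ ≤ 80 := by
  have hr : (0 : ℝ) < ((r : ℝ) + 1) + 1 := by positivity
  have hc := card_annulus_succ_four_le r
  rw [← div_eq_mul_inv, div_le_iff₀ (by positivity)]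
  calc ((annulus 4 r (r + 1)).card : ℝ) ≤ 80 * ((r : ℝ) + 1) ^ 3 := hc
    _ ≤ 80 * (((r : ℝ) + 1) + 1) ^ 3 := by gcongr; linarith

/-- [folklore] **THE LINEAR WINDOW COUNT**: `Σ_{z ∈ box 4 N} (‖z‖∞+1)⁻³ ≤ 1 + 80·N` on `ℤ⁴` — the origin contributes `1`, each shell `‖z‖∞ = r+1 ≤ N` at most `80`.
(A degree-3 profile is the one-difference letter of a long-range `ℤ⁴` leg; its window mass grows LINEARLY, with no logarithm.) -/
theorem sum_box_inv_cube_le (N : ℕ) :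
    ∑ z ∈ box 4 N, (((supNorm z : ℝ) + 1) ^ 3)⁻¹ ≤ 1 + 80 * (N : ℝ) := by
  set g : Pt → ℝ := fun z => (((supNorm z : ℝ) + 1) ^ 3)⁻¹ with hg
  have h0 : ∑ z ∈ box 4 0, g z = 1 := by
    rw [box_four_zero, Finset.sum_singleton]
    have : supNorm (0 : Pt) = 0 := supNorm_eq_zero_iff.mpr rfl
    simp [hg, this]
  have hshell : ∀ r : ℕ, ∑ z ∈ annulus 4 r (r + 1), g z ≤ 80 := by
    intro r
    have hcongr : ∀ z ∈ annulus 4 r (r + 1), g z = ((((r : ℝ) + 1) + 1) ^ 3)⁻¹ := by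
      intro z hz
      have hs : (supNorm z : ℝ) = (r : ℝ) + 1 := by rw [supNorm_eq_of_mem_sphere hz]; push_cast; ring
      simp only [hg, hs]
    rw [Finset.sum_congr rfl hcongr, Finset.sum_const, nsmul_eq_mul]
    exact shell_inv_cube_le r
  rw [sum_box_eq_sum_box_add_sum_annulus g (Nat.zero_le N), h0, sum_annulus_zero_eq_sum_shells]
  have h1 : ∑ r ∈ Finset.range N, ∑ z ∈ annulus 4 r (r + 1), g z ≤ ∑ _r ∈ Finset.range N, (80 : ℝ) :=
    Finset.sum_le_sum fun r _ => hshell r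
  rw [Finset.sum_const, Finset.card_range, nsmul_eq_mul] at h1
  linarith

/-- [folklore] **THE WINDOW's `(1 + (‖z‖∕n)²)`-WEIGHTED MASS OF A DEGREE-3 PROFILE**: for every finite `T ⊂ ℤ⁴`, window radius `N` and blocking `n ≥ 1`,
`Σ_{z∈T, ‖z‖∞≤N} (1 + (‖z‖∞∕n)²)·C∕(‖z‖∞+1)³ ≤ (1 + 80N)·((1 + (N∕n)²)·C)` (`C ≥ 0`): the weight is `≤ 1 + (N∕n)²` on the window, the profile's window count is
`sum_box_inv_cube_le`. -/
theorem sum_window_sqWeight_le {C : ℝ} (hC : 0 ≤ C) {n : ℕ} (hn : 1 ≤ n) (N : ℕ) (T : Finset Pt) :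
    ∑ z ∈ T, (if supNorm z ≤ N then (1 + ((supNorm z : ℝ) / n) ^ 2) * (C / ((supNorm z : ℝ) + 1) ^ 3) else 0)
      ≤ (1 + 80 * (N : ℝ)) * ((1 + ((N : ℝ) / n) ^ 2) * C) := by
  have hn' : (0 : ℝ) < n := by exact_mod_cast hn
  set G : Pt → ℝ := fun z => if supNorm z ≤ N then (1 + ((supNorm z : ℝ) / n) ^ 2) * (C / ((supNorm z : ℝ) + 1) ^ 3) else 0 with hG
  have hG0 : ∀ z, 0 ≤ G z := fun z => by
    simp only [hG]
    split_ifs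
    · positivity
    · exact le_rfl
  -- the finite set sits in a ball `box 4 R` containing the window
  set R : ℕ := max N (T.sup supNorm) with hR
  have hNR : N ≤ R := le_max_left _ _
  have hTR : T ⊆ box 4 R := subset_box_max T N
  have h1 : ∑ z ∈ T, G z ≤ ∑ z ∈ box 4 R, G z := Finset.sum_le_sum_of_subset_of_nonneg hTR fun z _ _ => hG0 z
  -- window + far annulus; `G` vanishes beyond the window
  rw [sum_box_eq_sum_box_add_sum_annulus G hNR] at h1
  have hfar : ∑ z ∈ annulus 4 N R, G z = 0 := by
    refine Finset.sum_eq_zero fun z hz => ?_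
    have hz' : N < supNorm z := (mem_annulus_iff.mp hz).1
    simp only [hG, if_neg (not_le.mpr hz')]
  rw [hfar, add_zero] at h1
  -- on the window the weight is at most `1 + (N/n)²`
  have hwin : ∀ z ∈ box 4 N, G z ≤ ((1 + ((N : ℝ) / n) ^ 2) * C) * (((supNorm z : ℝ) + 1) ^ 3)⁻¹ := by
    intro z hz
    have hzN : supNorm z ≤ N := mem_box_iff.mp hz
    have hzN' : (supNorm z : ℝ) ≤ N := by exact_mod_cast hzN
    have hz0 : 0 ≤ (supNorm z : ℝ) := supNorm_cast_nonneg z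
    simp only [hG, if_pos hzN]
    rw [show (1 + ((supNorm z : ℝ) / n) ^ 2) * (C / ((supNorm z : ℝ) + 1) ^ 3)
        = ((1 + ((supNorm z : ℝ) / n) ^ 2) * C) * (((supNorm z : ℝ) + 1) ^ 3)⁻¹ by ring]
    refine mul_le_mul_of_nonneg_right ?_ (by positivity)
    gcongr
  calc ∑ z ∈ T, G z ≤ ∑ z ∈ box 4 N, G z := h1
    _ ≤ ∑ z ∈ box 4 N, ((1 + ((N : ℝ) / n) ^ 2) * C) * (((supNorm z : ℝ) + 1) ^ 3)⁻¹ := Finset.sum_le_sum hwin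
    _ = ((1 + ((N : ℝ) / n) ^ 2) * C) * ∑ z ∈ box 4 N, (((supNorm z : ℝ) + 1) ^ 3)⁻¹ := by rw [Finset.mul_sum]
    _ ≤ ((1 + ((N : ℝ) / n) ^ 2) * C) * (1 + 80 * (N : ℝ)) :=
        mul_le_mul_of_nonneg_left (sum_box_inv_cube_le N) (by positivity)
    _ = (1 + 80 * (N : ℝ)) * ((1 + ((N : ℝ) / n) ^ 2) * C) := by ring

/-! ## §1 (g1) The one-long-leg window term in (Mκ) currency -/

section Window

variable {k : Pt → Pt → ℝ} {C δ : ℝ} {n N : ℕ}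

/-- [folklore] **(Mκ₁) — THE WINDOW OF A ONE-SMOOTH-LEG × ONE-LONG-LEG BUBBLE IN (Mκ) CURRENCY.**  Letters: (win-0) `k` vanishes beyond the window
(`N < ‖b′−b‖∞ → k b b′ = 0`); (win) on it `|k b b′| ≤ C∕(‖b′−b‖∞+1)³` (the product of a window sup letter and a degree-3 profile letter — ONE difference on the long
leg).  Then for every finite fine window `S` and coarse reference row `v₀`,
`Σ_{b∈S} Σ_{b′∈S} e^{−(δ∕(2n))‖b−n•v₀‖∞}·(1 + (‖b′−b‖∞∕n)²)·|k b b′| ≤ (1 + 480·e^{δ∕4}·(4∕δ)⁴)·n⁴·((1 + 80N)·((1 + (N∕n)²)·C))`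
— the `hMκ` binder of `MixLoopPowerCountingMassQuartic.coarse_secondMoment_of_majorant` at `κ := |k|`; NO logarithm of `N`. -/
theorem majorantLetter_window (hδ : 0 < δ) (hC : 0 ≤ C) (hn : 1 ≤ n) (N : ℕ) (S : Finset Pt) (v₀ : Pt)
    (hk0 : ∀ b b', N < supNorm (b' - b) → k b b' = 0)
    (hkwin : ∀ b b', supNorm (b' - b) ≤ N → |k b b'| ≤ C / ((supNorm (b' - b) : ℝ) + 1) ^ 3) :
    ∑ b ∈ S, ∑ b' ∈ S, Real.exp (-(δ / (2 * n)) * (supNorm (b - (n : ℤ) • v₀) : ℝ)) *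
        (1 + ((supNorm (b' - b) : ℝ) / n) ^ 2) * |k b b'|
      ≤ (1 + 480 * Real.exp (δ / 4) * (4 / δ) ^ 4) * (n : ℝ) ^ 4 * ((1 + 80 * (N : ℝ)) * ((1 + ((N : ℝ) / n) ^ 2) * C)) := by
  set G : Pt → ℝ := fun z => if supNorm z ≤ N then (1 + ((supNorm z : ℝ) / n) ^ 2) * (C / ((supNorm z : ℝ) + 1) ^ 3) else 0 with hG
  set B : ℝ := (1 + 80 * (N : ℝ)) * ((1 + ((N : ℝ) / n) ^ 2) * C) with hB
  -- pointwise: the weighted kernel is under the window profile of the separation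
  have hpt : ∀ b b', (1 + ((supNorm (b' - b) : ℝ) / n) ^ 2) * |k b b'| ≤ G (b' - b) := by
    intro b b'
    by_cases h : supNorm (b' - b) ≤ N
    · simp only [hG, if_pos h]
      exact mul_le_mul_of_nonneg_left (hkwin b b' h) (by positivity)
    · simp only [hG, if_neg h, hk0 b b' (not_le.mp h), abs_zero, mul_zero, le_refl]
  -- inner sum over the running insertion, uniformly in the reference insertion `b`
  have hinner : ∀ b, ∑ b' ∈ S, (1 + ((supNorm (b' - b) : ℝ) / n) ^ 2) * |k b b'| ≤ B := by
    intro b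
    calc ∑ b' ∈ S, (1 + ((supNorm (b' - b) : ℝ) / n) ^ 2) * |k b b'| ≤ ∑ b' ∈ S, G (b' - b) := Finset.sum_le_sum fun b' _ => hpt b b'
      _ = ∑ z ∈ S.image (fun b' => b' - b), G z := by
          rw [Finset.sum_image fun x _ y _ hxy => sub_left_injective hxy]
      _ ≤ B := sum_window_sqWeight_le hC hn N _
  have hB0 : 0 ≤ B := by positivity
  calc ∑ b ∈ S, ∑ b' ∈ S, Real.exp (-(δ / (2 * n)) * (supNorm (b - (n : ℤ) • v₀) : ℝ)) *
          (1 + ((supNorm (b' - b) : ℝ) / n) ^ 2) * |k b b'|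
      = ∑ b ∈ S, Real.exp (-(δ / (2 * n)) * (supNorm (b - (n : ℤ) • v₀) : ℝ)) *
          ∑ b' ∈ S, (1 + ((supNorm (b' - b) : ℝ) / n) ^ 2) * |k b b'| := by
        refine Finset.sum_congr rfl fun b _ => ?_
        rw [Finset.mul_sum]
        exact Finset.sum_congr rfl fun b' _ => by ring
    _ ≤ ∑ b ∈ S, Real.exp (-(δ / (2 * n)) * (supNorm (b - (n : ℤ) • v₀) : ℝ)) * B :=
        Finset.sum_le_sum fun b _ => mul_le_mul_of_nonneg_left (hinner b) (Real.exp_pos _).le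
    _ = (∑ b ∈ S, Real.exp (-(δ / (2 * n)) * (supNorm (b - (n : ℤ) • v₀) : ℝ))) * B := by rw [Finset.sum_mul]
    _ ≤ ((1 + 480 * Real.exp (δ / 4) * (4 / δ) ^ 4) * (n : ℝ) ^ 4) * B :=
        mul_le_mul_of_nonneg_right (sum_exp_recentre_le hδ hn S _) hB0
    _ = _ := by simp only [hB]

/-- [folklore] **(g1) FROM THE TWO LEG LETTERS — THE BINDING CHECK AS A HYPOTHESIS**: if on the window the piece is `c·L_R(b,b′)·L_F(b′−b)` with a window sup
letter `|L_R b b′| ≤ B₁` (the smooth leg's ONE difference, instance `B₁ = K₁·n⁻³`) and a degree-3 profile letter `|L_F z| ≤ A₁∕(‖z‖∞+1)³` (the long leg's ONE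
difference), and it vanishes beyond the window, then (Mκ₁) holds with `C = |c|·B₁·A₁`. -/
theorem majorantLetter_window_of_legs {L_R : Pt → Pt → ℝ} {L_F : Pt → ℝ} {B₁ A₁ c : ℝ} (hδ : 0 < δ) (hB₁ : 0 ≤ B₁) (hA₁ : 0 ≤ A₁) (hn : 1 ≤ n)
    (N : ℕ) (S : Finset Pt) (v₀ : Pt)
    (hR : ∀ b b', supNorm (b' - b) ≤ N → |L_R b b'| ≤ B₁)
    (hF : ∀ z : Pt, supNorm z ≤ N → |L_F z| ≤ A₁ / ((supNorm z : ℝ) + 1) ^ 3)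
    (hk0 : ∀ b b', N < supNorm (b' - b) → k b b' = 0)
    (hkwin : ∀ b b', supNorm (b' - b) ≤ N → k b b' = c * (L_R b b' * L_F (b' - b))) :
    ∑ b ∈ S, ∑ b' ∈ S, Real.exp (-(δ / (2 * n)) * (supNorm (b - (n : ℤ) • v₀) : ℝ)) *
        (1 + ((supNorm (b' - b) : ℝ) / n) ^ 2) * |k b b'|
      ≤ (1 + 480 * Real.exp (δ / 4) * (4 / δ) ^ 4) * (n : ℝ) ^ 4 *
          ((1 + 80 * (N : ℝ)) * ((1 + ((N : ℝ) / n) ^ 2) * (|c| * B₁ * A₁))) := by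
  refine majorantLetter_window hδ (by positivity) hn N S v₀ hk0 fun b b' h => ?_
  rw [hkwin b b' h, abs_mul, abs_mul]
  have h1 := hR b b' h
  have h2 := hF (b' - b) h
  have hden : (0 : ℝ) < ((supNorm (b' - b) : ℝ) + 1) ^ 3 := by have := supNorm_cast_nonneg (b' - b); positivity
  calc |c| * (|L_R b b'| * |L_F (b' - b)|) ≤ |c| * (B₁ * (A₁ / ((supNorm (b' - b) : ℝ) + 1) ^ 3)) :=
        mul_le_mul_of_nonneg_left (mul_le_mul h1 h2 (abs_nonneg _) hB₁) (abs_nonneg c)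
    _ = |c| * B₁ * A₁ / ((supNorm (b' - b) : ℝ) + 1) ^ 3 := by ring

/-- [folklore] The instance arithmetic at the blocking scale: `n⁴·((1 + 80n)·((1 + (n∕n)²)·(X∕n³))) ≤ 162·X·n²` (`X ≥ 0`, `n ≥ 1`; `1 + 80n ≤ 81n`). -/
theorem scale_window_arith {X : ℝ} (hX : 0 ≤ X) (hn : 1 ≤ n) :
    (n : ℝ) ^ 4 * ((1 + 80 * (n : ℝ)) * ((1 + ((n : ℝ) / n) ^ 2) * (X / (n : ℝ) ^ 3))) ≤ 162 * X * (n : ℝ) ^ 2 := by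
  have hn' : (1 : ℝ) ≤ n := by exact_mod_cast hn
  have hn0 : (0 : ℝ) < n := by linarith
  have e1 : (n : ℝ) / n = 1 := div_self hn0.ne'
  rw [e1]
  have e2 : (n : ℝ) ^ 4 * ((1 + 80 * (n : ℝ)) * ((1 + (1 : ℝ) ^ 2) * (X / (n : ℝ) ^ 3))) = 2 * (1 + 80 * (n : ℝ)) * n * X := by
    field_simp
    ring
  rw [e2]
  have h81 : 1 + 80 * (n : ℝ) ≤ 81 * n := by linarith
  nlinarith [mul_nonneg (mul_nonneg (by linarith : (0 : ℝ) ≤ 81 * n - (1 + 80 * n)) hn0.le) hX]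

/-- [folklore] **(g1) AT THE BLOCKING SCALE — THE INSTANCE POWER `n²`** (window radius `N = n`, smooth-leg difference letter `B₁ = B∕n³`):
`Σ_{b∈S} Σ_{b′∈S} e^{−(δ∕(2n))‖b−n•v₀‖∞}·(1 + (‖b′−b‖∞∕n)²)·|k b b′| ≤ (1 + 480·e^{δ∕4}·(4∕δ)⁴)·(162·(|c|·A₁·B))·n²`
— the same `n²` display as the far window (g2) (`GhostLoopCountingFar.majorantLetter_far`); the units of `A₁, B, c` are RHOA-6e's bookkeeping. -/
theorem majorantLetter_window_scale {L_R : Pt → Pt → ℝ} {L_F : Pt → ℝ} {B A₁ c : ℝ} (hδ : 0 < δ) (hB : 0 ≤ B) (hA₁ : 0 ≤ A₁) (hn : 1 ≤ n)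
    (S : Finset Pt) (v₀ : Pt)
    (hR : ∀ b b', supNorm (b' - b) ≤ n → |L_R b b'| ≤ B / (n : ℝ) ^ 3)
    (hF : ∀ z : Pt, supNorm z ≤ n → |L_F z| ≤ A₁ / ((supNorm z : ℝ) + 1) ^ 3)
    (hk0 : ∀ b b', n < supNorm (b' - b) → k b b' = 0)
    (hkwin : ∀ b b', supNorm (b' - b) ≤ n → k b b' = c * (L_R b b' * L_F (b' - b))) :
    ∑ b ∈ S, ∑ b' ∈ S, Real.exp (-(δ / (2 * n)) * (supNorm (b - (n : ℤ) • v₀) : ℝ)) *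
        (1 + ((supNorm (b' - b) : ℝ) / n) ^ 2) * |k b b'|
      ≤ (1 + 480 * Real.exp (δ / 4) * (4 / δ) ^ 4) * (162 * (|c| * A₁ * B)) * (n : ℝ) ^ 2 := by
  have hn0 : (0 : ℝ) < n := by exact_mod_cast hn
  have hB₁ : 0 ≤ B / (n : ℝ) ^ 3 := by positivity
  have h := majorantLetter_window_of_legs (k := k) hδ hB₁ hA₁ hn n S v₀ hR hF hk0 hkwin
  refine h.trans ?_
  have e : |c| * (B / (n : ℝ) ^ 3) * A₁ = (|c| * A₁ * B) / (n : ℝ) ^ 3 := by ring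
  rw [e]
  set Θ : ℝ := 1 + 480 * Real.exp (δ / 4) * (4 / δ) ^ 4 with hΘdef
  have hΘ : 0 ≤ Θ := by positivity
  have key := scale_window_arith (X := |c| * A₁ * B) (by positivity) hn
  calc Θ * (n : ℝ) ^ 4 * ((1 + 80 * (n : ℝ)) * ((1 + ((n : ℝ) / n) ^ 2) * (|c| * A₁ * B / (n : ℝ) ^ 3)))
      = Θ * ((n : ℝ) ^ 4 * ((1 + 80 * (n : ℝ)) * ((1 + ((n : ℝ) / n) ^ 2) * (|c| * A₁ * B / (n : ℝ) ^ 3)))) := by ring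
    _ ≤ Θ * (162 * (|c| * A₁ * B) * (n : ℝ) ^ 2) := mul_le_mul_of_nonneg_left key hΘ
    _ = Θ * (162 * (|c| * A₁ * B)) * (n : ℝ) ^ 2 := by ring

end Window

/-! ## §2 (g1) The smooth–smooth window term `½[∇E·∇E]` — an ultra-local-type piece, `GhostLoopCountingFar.majorantLetter_local` BY NAME -/

section Smooth

variable {k : Pt → Pt → ℝ} {δ : ℝ} {n : ℕ}

/-- [folklore] **THE SMOOTH–SMOOTH WINDOW TERM IN (Mκ) CURRENCY**: on the window `k = c·L_R(b,b′)·L_R′(b,b′)` with two window sup letters `|L_R| ≤ B₁`,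
`|L_R′| ≤ B₁′` (ONE difference on each smooth leg), zero beyond it ⟹ (Mκ) with `A_κ = (1 + 480·e^{δ∕4}·(4∕δ)⁴)·n⁴·((2N+1)⁴·((1 + (N∕n)²)·(|c|·B₁·B₁′)))`
— `GhostLoopCountingFar.majorantLetter_local` at `r = N`, `C_loc = |c|·B₁·B₁′`. -/
theorem majorantLetter_window_smooth {L_R L_R' : Pt → Pt → ℝ} {B₁ B₁' c : ℝ} (hδ : 0 < δ) (hB₁ : 0 ≤ B₁) (hB₁' : 0 ≤ B₁') (hn : 1 ≤ n)
    (N : ℕ) (S : Finset Pt) (v₀ : Pt)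
    (hR : ∀ b b', supNorm (b' - b) ≤ N → |L_R b b'| ≤ B₁) (hR' : ∀ b b', supNorm (b' - b) ≤ N → |L_R' b b'| ≤ B₁')
    (hk0 : ∀ b b', N < supNorm (b' - b) → k b b' = 0)
    (hkwin : ∀ b b', supNorm (b' - b) ≤ N → k b b' = c * (L_R b b' * L_R' b b')) :
    ∑ b ∈ S, ∑ b' ∈ S, Real.exp (-(δ / (2 * n)) * (supNorm (b - (n : ℤ) • v₀) : ℝ)) *
        (1 + ((supNorm (b' - b) : ℝ) / n) ^ 2) * |k b b'|
      ≤ (1 + 480 * Real.exp (δ / 4) * (4 / δ) ^ 4) * (n : ℝ) ^ 4 *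
          ((2 * (N : ℝ) + 1) ^ 4 * ((1 + ((N : ℝ) / n) ^ 2) * (|c| * B₁ * B₁'))) := by
  refine majorantLetter_local hδ (by positivity) hn N S v₀ hk0 fun b b' h => ?_
  rw [hkwin b b' h, abs_mul, abs_mul, mul_assoc]
  exact mul_le_mul_of_nonneg_left (mul_le_mul (hR b b' h) (hR' b b' h) (abs_nonneg _) hB₁) (abs_nonneg c)

/-- [folklore] The instance arithmetic at the blocking scale for the smooth–smooth term:
`n⁴·((2n+1)⁴·((1 + (n∕n)²)·(X∕n³∕n³))) ≤ 162·X·n²` (`X ≥ 0`, `n ≥ 1`; `(2n+1)⁴ ≤ 81n⁴`). -/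
theorem scale_smooth_arith {X : ℝ} (hX : 0 ≤ X) (hn : 1 ≤ n) :
    (n : ℝ) ^ 4 * ((2 * (n : ℝ) + 1) ^ 4 * ((1 + ((n : ℝ) / n) ^ 2) * (X / (n : ℝ) ^ 3 / (n : ℝ) ^ 3))) ≤ 162 * X * (n : ℝ) ^ 2 := by
  have hn' : (1 : ℝ) ≤ n := by exact_mod_cast hn
  have hn0 : (0 : ℝ) < n := by linarith
  have e1 : (n : ℝ) / n = 1 := div_self hn0.ne'
  rw [e1]
  have h3 : 2 * (n : ℝ) + 1 ≤ 3 * n := by linarith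
  have h81 : (2 * (n : ℝ) + 1) ^ 4 ≤ (3 * (n : ℝ)) ^ 4 := pow_le_pow_left₀ (by positivity) h3 4
  calc (n : ℝ) ^ 4 * ((2 * (n : ℝ) + 1) ^ 4 * ((1 + (1 : ℝ) ^ 2) * (X / (n : ℝ) ^ 3 / (n : ℝ) ^ 3)))
      ≤ (n : ℝ) ^ 4 * ((3 * (n : ℝ)) ^ 4 * ((1 + (1 : ℝ) ^ 2) * (X / (n : ℝ) ^ 3 / (n : ℝ) ^ 3))) := by
        gcongr
    _ = 162 * X * (n : ℝ) ^ 2 := by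
        field_simp
        ring

/-- [folklore] **THE SMOOTH–SMOOTH TERM AT THE BLOCKING SCALE** (`N = n`, `B₁ = B∕n³`, `B₁′ = B′∕n³`): `A_κ ≤ (1 + 480·e^{δ∕4}·(4∕δ)⁴)·(162·(|c|·B·B′))·n²`. -/
theorem majorantLetter_window_smooth_scale {L_R L_R' : Pt → Pt → ℝ} {B B' c : ℝ} (hδ : 0 < δ) (hB : 0 ≤ B) (hB' : 0 ≤ B') (hn : 1 ≤ n)
    (S : Finset Pt) (v₀ : Pt)
    (hR : ∀ b b', supNorm (b' - b) ≤ n → |L_R b b'| ≤ B / (n : ℝ) ^ 3)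
    (hR' : ∀ b b', supNorm (b' - b) ≤ n → |L_R' b b'| ≤ B' / (n : ℝ) ^ 3)
    (hk0 : ∀ b b', n < supNorm (b' - b) → k b b' = 0)
    (hkwin : ∀ b b', supNorm (b' - b) ≤ n → k b b' = c * (L_R b b' * L_R' b b')) :
    ∑ b ∈ S, ∑ b' ∈ S, Real.exp (-(δ / (2 * n)) * (supNorm (b - (n : ℤ) • v₀) : ℝ)) *
        (1 + ((supNorm (b' - b) : ℝ) / n) ^ 2) * |k b b'|
      ≤ (1 + 480 * Real.exp (δ / 4) * (4 / δ) ^ 4) * (162 * (|c| * B * B')) * (n : ℝ) ^ 2 := by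
  have hn0 : (0 : ℝ) < n := by exact_mod_cast hn
  have hB₁ : 0 ≤ B / (n : ℝ) ^ 3 := by positivity
  have hB₁' : 0 ≤ B' / (n : ℝ) ^ 3 := by positivity
  have h := majorantLetter_window_smooth (k := k) hδ hB₁ hB₁' hn n S v₀ hR hR' hk0 hkwin
  refine h.trans ?_
  have e : |c| * (B / (n : ℝ) ^ 3) * (B' / (n : ℝ) ^ 3) = (|c| * B * B') / (n : ℝ) ^ 3 / (n : ℝ) ^ 3 := by ring
  rw [e]
  set Θ : ℝ := 1 + 480 * Real.exp (δ / 4) * (4 / δ) ^ 4 with hΘdef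
  have hΘ : 0 ≤ Θ := by positivity
  have key := scale_smooth_arith (X := |c| * B * B') (by positivity) hn
  calc Θ * (n : ℝ) ^ 4 * ((2 * (n : ℝ) + 1) ^ 4 * ((1 + ((n : ℝ) / n) ^ 2) * (|c| * B * B' / (n : ℝ) ^ 3 / (n : ℝ) ^ 3)))
      = Θ * ((n : ℝ) ^ 4 * ((2 * (n : ℝ) + 1) ^ 4 * ((1 + ((n : ℝ) / n) ^ 2) * (|c| * B * B' / (n : ℝ) ^ 3 / (n : ℝ) ^ 3)))) := by ring
    _ ≤ Θ * (162 * (|c| * B * B') * (n : ℝ) ^ 2) := mul_le_mul_of_nonneg_left key hΘ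
    _ = Θ * (162 * (|c| * B * B')) * (n : ℝ) ^ 2 := by ring

end Smooth

/-! ## §3 The three window terms of (g1) together -/

/-- [folklore] (Mκ) LETTERS ADD, three pieces (`GhostLoopCountingFar.majorantLetter_add` twice). -/
theorem majorantLetter_add₃ {k₁ k₂ k₃ : Pt → Pt → ℝ} {w : Pt → ℝ} {W : Pt → Pt → ℝ} {A₁ A₂ A₃ : ℝ} (S : Finset Pt)
    (hw : ∀ b, 0 ≤ w b) (hW : ∀ b b', 0 ≤ W b b')
    (h₁ : ∑ b ∈ S, ∑ b' ∈ S, w b * W b b' * |k₁ b b'| ≤ A₁) (h₂ : ∑ b ∈ S, ∑ b' ∈ S, w b * W b b' * |k₂ b b'| ≤ A₂)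
    (h₃ : ∑ b ∈ S, ∑ b' ∈ S, w b * W b b' * |k₃ b b'| ≤ A₃) :
    ∑ b ∈ S, ∑ b' ∈ S, w b * W b b' * |k₁ b b' + k₂ b b' + k₃ b b'| ≤ A₁ + A₂ + A₃ :=
  majorantLetter_add (k₁ := fun b b' => k₁ b b' + k₂ b b') (k₂ := k₃) S hw hW (majorantLetter_add S hw hW h₁ h₂) h₃

/-- [folklore] **(Mκ₁) — THE WINDOW MISMATCH OF THE GHOST BUBBLE AT THE BLOCKING SCALE, ALL THREE TERMS**: on the window `‖b′−b‖∞ ≤ n` the piece is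
`k₁ + k₂ + k₃` with `k₁ = c₁·L_R·L_F` (smooth × long), `k₂ = c₂·L_R′·L_F′` (the transposed cross term, written with the long leg's profile read at `b′−b` as well —
a consumer reading it at `b−b′` uses `‖b−b′‖∞ = ‖b′−b‖∞`), `k₃ = c₃·L_R·L_R′` (smooth × smooth), each vanishing beyond the window; letters `|L_R| ≤ B∕n³`, `|L_R′| ≤ B′∕n³`
(window sup letters of the smooth legs' ONE difference), `|L_F z|, |L_F′ z| ≤ A₁, A₁′∕(‖z‖∞+1)³` (degree-3 profiles of the long legs' ONE difference) ⟹
`A_κ₁ = (1 + 480·e^{δ∕4}·(4∕δ)⁴)·(162·(|c₁|·A₁·B) + 162·(|c₂|·A₁′·B′) + 162·(|c₃|·B·B′))·n²`. -/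
theorem majorantLetter_mismatch_scale {k₁ k₂ k₃ : Pt → Pt → ℝ} {L_R L_R' : Pt → Pt → ℝ} {L_F L_F' : Pt → ℝ}
    {B B' A₁ A₁' c₁ c₂ c₃ δ : ℝ} {n : ℕ} (hδ : 0 < δ) (hB : 0 ≤ B) (hB' : 0 ≤ B') (hA₁ : 0 ≤ A₁) (hA₁' : 0 ≤ A₁') (hn : 1 ≤ n)
    (S : Finset Pt) (v₀ : Pt)
    (hR : ∀ b b', supNorm (b' - b) ≤ n → |L_R b b'| ≤ B / (n : ℝ) ^ 3)
    (hR' : ∀ b b', supNorm (b' - b) ≤ n → |L_R' b b'| ≤ B' / (n : ℝ) ^ 3)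
    (hF : ∀ z : Pt, supNorm z ≤ n → |L_F z| ≤ A₁ / ((supNorm z : ℝ) + 1) ^ 3)
    (hF' : ∀ z : Pt, supNorm z ≤ n → |L_F' z| ≤ A₁' / ((supNorm z : ℝ) + 1) ^ 3)
    (h₁0 : ∀ b b', n < supNorm (b' - b) → k₁ b b' = 0) (h₁ : ∀ b b', supNorm (b' - b) ≤ n → k₁ b b' = c₁ * (L_R b b' * L_F (b' - b)))
    (h₂0 : ∀ b b', n < supNorm (b' - b) → k₂ b b' = 0) (h₂ : ∀ b b', supNorm (b' - b) ≤ n → k₂ b b' = c₂ * (L_R' b b' * L_F' (b' - b)))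
    (h₃0 : ∀ b b', n < supNorm (b' - b) → k₃ b b' = 0) (h₃ : ∀ b b', supNorm (b' - b) ≤ n → k₃ b b' = c₃ * (L_R b b' * L_R' b b')) :
    ∑ b ∈ S, ∑ b' ∈ S, Real.exp (-(δ / (2 * n)) * (supNorm (b - (n : ℤ) • v₀) : ℝ)) *
        (1 + ((supNorm (b' - b) : ℝ) / n) ^ 2) * |k₁ b b' + k₂ b b' + k₃ b b'|
      ≤ (1 + 480 * Real.exp (δ / 4) * (4 / δ) ^ 4) *
          (162 * (|c₁| * A₁ * B) + 162 * (|c₂| * A₁' * B') + 162 * (|c₃| * B * B')) * (n : ℝ) ^ 2 := by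
  have e : (1 + 480 * Real.exp (δ / 4) * (4 / δ) ^ 4) *
        (162 * (|c₁| * A₁ * B) + 162 * (|c₂| * A₁' * B') + 162 * (|c₃| * B * B')) * (n : ℝ) ^ 2
      = (1 + 480 * Real.exp (δ / 4) * (4 / δ) ^ 4) * (162 * (|c₁| * A₁ * B)) * (n : ℝ) ^ 2
        + (1 + 480 * Real.exp (δ / 4) * (4 / δ) ^ 4) * (162 * (|c₂| * A₁' * B')) * (n : ℝ) ^ 2
        + (1 + 480 * Real.exp (δ / 4) * (4 / δ) ^ 4) * (162 * (|c₃| * B * B')) * (n : ℝ) ^ 2 := by ring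
  rw [e]
  exact majorantLetter_add₃ S (fun b => (Real.exp_pos _).le) (fun b b' => by positivity)
    (majorantLetter_window_scale hδ hB hA₁ hn S v₀ hR hF h₁0 h₁)
    (majorantLetter_window_scale hδ hB' hA₁' hn S v₀ hR' hF' h₂0 h₂)
    (majorantLetter_window_smooth_scale hδ hB hB' hn S v₀ hR hR' h₃0 h₃)

/-! ## §4 The J-contraction BY NAME -/

section Contract

variable {k : Pt → Pt → ℝ} {J : Pt → Pt → ℝ} {C C_J C_J' A_κ δ : ℝ} {n : ℕ}

/-- [folklore] **THE J-CONTRACTION OF A PIECE WITH AN (Mκ) LETTER** — `MixLoopPowerCountingMassQuartic.coarse_secondMoment_of_majorant` at `κ := |k|` (`hk := le_rfl`):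
under the reference-leg letter (J), the running-leg coarse moments (J′) and an (Mκ) letter `A_κ` for `|k|`,
`Σ_{v∈V} ‖v−v₀‖∞²·|Σ_{b,b′∈S} J b v₀·J b′ v·k b b′| ≤ 3·C_J·C_J′·(1 + 16∕δ²)·A_κ`. -/
theorem secondMoment_of_majorantLetter (hδ : 0 < δ) (hn : 1 ≤ n) (S V : Finset Pt) (v₀ : Pt)
    (hJ : ∀ b, |J b v₀| ≤ C_J * Real.exp (-(δ / n) * (supNorm (b - (n : ℤ) • v₀) : ℝ)))
    (hJ' : ∀ b', ∑ v ∈ V, (1 + ((supNorm (b' - (n : ℤ) • v) : ℝ) / n) ^ 2) * |J b' v| ≤ C_J')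
    (hMκ : ∑ b ∈ S, ∑ b' ∈ S, Real.exp (-(δ / (2 * n)) * (supNorm (b - (n : ℤ) • v₀) : ℝ)) *
        (1 + ((supNorm (b' - b) : ℝ) / n) ^ 2) * |k b b'| ≤ A_κ) :
    ∑ v ∈ V, (supNorm (v - v₀) : ℝ) ^ 2 * |∑ b ∈ S, ∑ b' ∈ S, J b v₀ * J b' v * k b b'|
      ≤ 3 * C_J * C_J' * (1 + 16 / δ ^ 2) * A_κ :=
  coarse_secondMoment_of_majorant (κ := fun b b' => |k b b'|) hδ hn S V v₀ (fun _ _ => le_rfl) hJ hJ' hMκ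

/-- [folklore] **(g1) J-CONTRACTED — THE COARSE SECOND MOMENT OF THE WINDOW TERM, n-POWERS DISPLAYED**: letters (win-0)∕(win) of `majorantLetter_window`, (J), (J′) ⟹
`Σ_{v∈V} ‖v−v₀‖∞²·|Σ_{b,b′∈S} J b v₀·J b′ v·k b b′| ≤ 3·C_J·C_J′·(1 + 16∕δ²)·((1 + 480·e^{δ∕4}·(4∕δ)⁴)·n⁴·((1 + 80N)·((1 + (N∕n)²)·C)))`. -/
theorem secondMoment_window (hδ : 0 < δ) (hC : 0 ≤ C) (hn : 1 ≤ n) (N : ℕ) (S V : Finset Pt) (v₀ : Pt)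
    (hk0 : ∀ b b', N < supNorm (b' - b) → k b b' = 0)
    (hkwin : ∀ b b', supNorm (b' - b) ≤ N → |k b b'| ≤ C / ((supNorm (b' - b) : ℝ) + 1) ^ 3)
    (hJ : ∀ b, |J b v₀| ≤ C_J * Real.exp (-(δ / n) * (supNorm (b - (n : ℤ) • v₀) : ℝ)))
    (hJ' : ∀ b', ∑ v ∈ V, (1 + ((supNorm (b' - (n : ℤ) • v) : ℝ) / n) ^ 2) * |J b' v| ≤ C_J') :
    ∑ v ∈ V, (supNorm (v - v₀) : ℝ) ^ 2 * |∑ b ∈ S, ∑ b' ∈ S, J b v₀ * J b' v * k b b'|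
      ≤ 3 * C_J * C_J' * (1 + 16 / δ ^ 2) *
          ((1 + 480 * Real.exp (δ / 4) * (4 / δ) ^ 4) * (n : ℝ) ^ 4 * ((1 + 80 * (N : ℝ)) * ((1 + ((N : ℝ) / n) ^ 2) * C))) :=
  secondMoment_of_majorantLetter hδ hn S V v₀ hJ hJ' (majorantLetter_window hδ hC hn N S v₀ hk0 hkwin)

end Contract

end Summit.QuantumFields.BalabanUV.Beta.FP.GhostLoopCountingWindow

end
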